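import Literature.Computability.Complexity.NegationElimination
import Literature.Computability.MetaComplexity.Resolution

/-!
# Crux `RamseyUncertifiable.ResolutionUncertainty` (stmt-PneNP-9816), line
# `jukna-game-monotone-interpolation`: stub `stub_monotoneExtraction`

The circuit PLUMBING of the monotone Karchmer–Wigderson / Krajíček reading of a resolution
refutation (Krajíček 1997 interpolation; folklore straight-line construction), independent of
any CNF. Given a list `π` of resolution lines whose premise indices point strictly backwards, a
classifier `isOr` of pivot variables (Alice's pivots become `∨` gates, Bob's pivots `∧` gates),
a leaf labelling `leaf : ℕ → ι ⊕ Bool` of the lines (an initial line reads an input variable or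
a constant) and an output line `r < π.length`, we build a straight-line circuit over
`monotoneBasis01 = {∧₂, ∨₂, 0, 1}` with exactly ONE gate per line — gate `t` is `x_i ∨ x_i`,
resp. the constant `b`, for an initial line with leaf `inl i`, resp. `inr b`; `g_i ∨ g_j` or
`g_i ∧ g_j` for a resolution step with premises `i, j`; `g_i ∨ g_i` for a weakening of line `i`
— together with the value function `val t z` (the value of gate `t` on input `z`), which
satisfies the evident recursion along the line DAG and whose value at `r` is the output of the
circuit. Everything is over the tree's `Circuit` / `GateList` calculus (`GateList.vals`,
`GateList.WF`, `GateList.toCircuit`, `GateList.getD_vals_append_cons`, `GateList.orGate`,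
`GateList.andGate`, `GateList.constGate`); no definitions, no cited facts.
[Krajíček 1997 interpolation / Karchmer–Wigderson; folklore straight-line construction]
-/

-- `Summit.PneNP.PneNP.…` repeats `PneNP` by the tree's layout (summit = problem); silence the core linter as the landed siblings do.
set_option linter.dupNamespace false

namespace Summit.PneNP.PneNP.Theorems.RamseyUncertifiableResolutionUncertainty

open Literature.Computability.Complexity Literature.Computability.MetaComplexity

namespace MonotoneExtraction

open GateList

variable {ι : Type*}

/-! ## Two facts on straight-line programs -/

/-- The value of gate `t` of a program is its truth table applied to the values of its wires,
read off the first `t` gate values. [folklore] -/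
theorem getD_vals_eq_op (gs : List (Gate ι)) (z : ι → Bool) {t : ℕ} (ht : t < gs.length) :
    (vals gs z).getD t false =
      (gs[t]).op (fun a => wireOf z (vals (gs.take t) z) ((gs[t]).args a)) := by
  have h := getD_vals_append_cons (gs.take t) gs[t] (gs.drop (t + 1)) z
  rw [List.length_take_of_le ht.le, ← List.drop_eq_getElem_cons ht, List.take_append_drop] at h
  exact h

/-- A wire into the first `t` gates carries, after `t` gates, its final value. [folklore] -/
theorem wireOf_vals_take (gs : List (Gate ι)) (z : ι → Bool) {i t : ℕ} (hi : i < t)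
    (ht : t ≤ gs.length) : wireOf z (vals (gs.take t) z) (.inr i) = (vals gs z).getD i false := by
  have h := wireOf_vals_append (gs.take t) (gs.drop t) z (.inr i)
    (fun m hm => by cases hm; rw [List.length_take_of_le ht]; exact hi)
  rw [List.take_append_drop] at h
  exact h.symm

/-! ## The two kinds of line gates -/

/-- The leaf gate of an initial line with leaf label `lf` — the input `x_i` as `x_i ∨ x_i` for
`lf = inl i`, the constant `b` for `lf = inr b` — is in `{∧₂, ∨₂, 0, 1}`. [folklore] -/
theorem leaf_fn_mem (lf : ι ⊕ Bool) :
    (lf.elim (fun i => orGate (.inl i) (.inl i)) (constGate ι)).fn ∈ monotoneBasis01 := by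
  cases lf with
  | inl i => exact monotoneBasis_subset_monotoneBasis01 or_mem_monotoneBasis
  | inr b =>
    show GateFn.const b ∈ monotoneBasis01
    cases b
    · exact Set.mem_insert_of_mem _ (Set.mem_insert _ _)
    · exact Set.mem_insert _ _

/-- A leaf gate reads no gate, so it is valid at every position. [folklore] -/
theorem gateOK_leaf (L : ℕ) (lf : ι ⊕ Bool) :
    GateOK L (lf.elim (fun i => orGate (.inl i) (.inl i)) (constGate ι)) := by
  cases lf with
  | inl i => exact gateOK_orGate (fun _ h => by cases h) (fun _ h => by cases h)
  | inr b => exact gateOK_constGate L b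

/-- The value of a leaf gate in terms of the values `w` of the wires: the leaf. [folklore] -/
theorem leaf_op (lf : ι ⊕ Bool) (w : ι ⊕ ℕ → Bool) :
    (lf.elim (fun i => orGate (.inl i) (.inl i)) (constGate ι)).op
        (fun a => w ((lf.elim (fun i => orGate (.inl i) (.inl i)) (constGate ι)).args a)) =
      Sum.elim (fun i => w (.inl i)) id lf := by
  cases lf with
  | inl i => exact (orGate_op _ _ w).trans (Bool.or_self _)
  | inr b => rfl

/-- The pivot gate of a resolution step — `∨₂` of the two premise wires for an Alice pivot
(`b = true`), `∧₂` for a Bob pivot — is in `{∧₂, ∨₂, 0, 1}`. [folklore] -/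
theorem pivot_fn_mem (b : Bool) (u v : ι ⊕ ℕ) :
    (bif b then orGate u v else andGate u v).fn ∈ monotoneBasis01 := by
  cases b
  · exact monotoneBasis_subset_monotoneBasis01 and_mem_monotoneBasis
  · exact monotoneBasis_subset_monotoneBasis01 or_mem_monotoneBasis

/-- A pivot gate on two valid wires is valid. [folklore] -/
theorem gateOK_pivot {L : ℕ} (b : Bool) {u v : ι ⊕ ℕ} (hu : OutOK L u) (hv : OutOK L v) :
    GateOK L (bif b then orGate u v else andGate u v) := by
  cases b
  · exact gateOK_andGate hu hv
  · exact gateOK_orGate hu hv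

/-- The value of a pivot gate in terms of the values `w` of the wires: `∨` or `∧` of the two
premise wires. [folklore] -/
theorem pivot_op (b : Bool) (u v : ι ⊕ ℕ) (w : ι ⊕ ℕ → Bool) :
    (bif b then orGate u v else andGate u v).op
        (fun a => w ((bif b then orGate u v else andGate u v).args a)) =
      (if b then (w u || w v) else (w u && w v)) := by
  cases b
  · exact andGate_op u v w
  · exact orGate_op u v w

end MonotoneExtraction

/-- **Monotone extraction along a line DAG** (registered stub `stub_monotoneExtraction` of the
line `jukna-game-monotone-interpolation`; the plumbing of Krajíček's 1997 interpolation / the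
monotone Karchmer–Wigderson game for resolution). For a line list `π` whose premise indices
point strictly backwards, a pivot classifier `isOr`, a leaf labelling `leaf` and an output line
`r < π.length`, there are a circuit `C` over `{∧₂, ∨₂, 0, 1}` with at most `π.length` gates and
a value function `val` with `C.eval z = val r z`, such that `val t z` is the leaf value (`z i`
or the constant) at an initial line, `val i z ∨ val j z` resp. `val i z ∧ val j z` at a
resolution step with premises `i, j` and an Alice resp. Bob pivot, and `val i z` at a weakening
of line `i`. Construction: one gate per line (gate `t` = the leaf gate, the pivot gate on the
gates `i, j`, or `g_i ∨ g_i`), output wire the gate of line `r`, `val t z` = the value of gate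
`t`. [folklore] -/
theorem stub_monotoneExtraction :
    ∀ (ι : Type) (π : List (ResLine ℕ)) (isOr : ℕ → Bool) (leaf : ℕ → ι ⊕ Bool) (r : ℕ),
      r < π.length →
      (∀ t (ht : t < π.length), ∀ i ∈ (π[t]'ht).premises, i < t) →
      ∃ (C : Circuit ι) (val : ℕ → (ι → Bool) → Bool),
        C.IsOver monotoneBasis01 ∧ C.size ≤ π.length ∧ (∀ z, C.eval z = val r z) ∧
        ∀ t (ht : t < π.length) (z : ι → Bool),
          val t z =
            (match (π[t]'ht).rule with
              | .initial => Sum.elim z id (leaf t)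
              | .resolve i j v => if isOr v then (val i z || val j z) else (val i z && val j z)
              | .weaken i => val i z) := by
  intro ι π isOr leaf r hr hback
  -- the gate of line `t` when its rule is `ρ`
  let gate : ℕ → ResRule ℕ → Gate ι := fun t ρ =>
    match ρ with
    | .initial => (leaf t).elim (fun i => GateList.orGate (.inl i) (.inl i)) (GateList.constGate ι)
    | .resolve i j v =>
      bif isOr v then GateList.orGate (.inr i) (.inr j) else GateList.andGate (.inr i) (.inr j)
    | .weaken i => GateList.orGate (.inr i) (.inr i)
  have hfn : ∀ t ρ, (gate t ρ).fn ∈ monotoneBasis01 := by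
    intro t ρ
    cases ρ with
    | initial => exact MonotoneExtraction.leaf_fn_mem (leaf t)
    | resolve i j v => exact MonotoneExtraction.pivot_fn_mem (isOr v) _ _
    | weaken i => exact monotoneBasis_subset_monotoneBasis01 GateList.or_mem_monotoneBasis
  have hok : ∀ t (ρ : ResRule ℕ), (∀ i ∈ ρ.premises, i < t) → GateList.GateOK t (gate t ρ) := by
    intro t ρ h
    have hprem : ∀ i ∈ ρ.premises, GateList.OutOK t (Sum.inr i : ι ⊕ ℕ) := fun i hi m hm => by
      cases hm
      exact h i hi
    cases ρ with
    | initial => exact MonotoneExtraction.gateOK_leaf t (leaf t)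
    | resolve i j v =>
      exact MonotoneExtraction.gateOK_pivot (isOr v) (hprem i (by simp [ResRule.premises]))
        (hprem j (by simp [ResRule.premises]))
    | weaken i =>
      exact GateList.gateOK_orGate (hprem i (by simp [ResRule.premises]))
        (hprem i (by simp [ResRule.premises]))
  have hop : ∀ t ρ (w : ι ⊕ ℕ → Bool), (gate t ρ).op (fun a => w ((gate t ρ).args a)) =
      (match ρ with
        | .initial => Sum.elim (fun i => w (.inl i)) id (leaf t)
        | .resolve i j v =>
          if isOr v then (w (.inr i) || w (.inr j)) else (w (.inr i) && w (.inr j))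
        | .weaken i => w (.inr i)) := by
    intro t ρ w
    cases ρ with
    | initial => exact MonotoneExtraction.leaf_op (leaf t) w
    | resolve i j v => exact MonotoneExtraction.pivot_op (isOr v) _ _ w
    | weaken i => exact (GateList.orGate_op _ _ w).trans (Bool.or_self _)
  -- the program: one gate per line
  let gs : List (Gate ι) := π.mapIdx fun t l => gate t l.rule
  have hlen : gs.length = π.length := List.length_mapIdx
  have hget : ∀ t (ht : t < π.length), gs[t]'(by rw [hlen]; exact ht) = gate t (π[t]'ht).rule :=
    fun t ht => List.getElem_mapIdx
  have hwf : GateList.WF gs := by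
    intro j g hj
    obtain ⟨hj', rfl⟩ := List.getElem?_eq_some_iff.1 hj
    have hjπ : j < π.length := by rw [← hlen]; exact hj'
    rw [hget j hjπ]
    exact hok j _ (hback j hjπ)
  -- the circuit (output: the gate of line `r`) and the value function (value of gate `t`)
  refine ⟨GateList.toCircuit gs (.inr r) hwf (fun m hm => by cases hm; rw [hlen]; exact hr),
    fun t z => (GateList.vals gs z).getD t false, fun g hg => ?_, hlen.le, fun z => rfl,
    fun t ht z => ?_⟩
  · -- every gate is in the basis
    obtain ⟨t, -, rfl⟩ := List.exists_of_mem_mapIdx hg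
    exact hfn t _
  · -- the recursion: gate `t` reads the (final) values of its premises `i, j < t`
    dsimp only
    have htg : t < gs.length := by rw [hlen]; exact ht
    have hw : ∀ i, i < t → GateList.wireOf z (GateList.vals (gs.take t) z) (.inr i) =
        (GateList.vals gs z).getD i false :=
      fun i hi => MonotoneExtraction.wireOf_vals_take gs z hi htg.le
    rw [MonotoneExtraction.getD_vals_eq_op gs z htg, hget t ht, hop]
    have hprem : ∀ i ∈ ((π[t]'ht).rule).premises, i < t := hback t ht
    revert hprem
    cases (π[t]'ht).rule with
    | initial => intro; rfl
    | resolve i j v =>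
      intro hprem
      dsimp only
      rw [hw i (hprem i (by simp [ResRule.premises])), hw j (hprem j (by simp [ResRule.premises]))]
    | weaken i =>
      intro hprem
      exact hw i (hprem i (by simp [ResRule.premises]))

end Summit.PneNP.PneNP.Theorems.RamseyUncertifiableResolutionUncertainty
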